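import Mathlib
import Literature.Analysis.FluidPDE.PeriodicNSOrbitPersistsProofs
import Literature.Analysis.FluidPDE.GalerkinFlow
import Summits.AnomalousDissipation.AnomalousDissipation.Theorems.WazewskiBlockUniformWorkFloorTrapStubPerturbedBorderedSolve
import Summits.AnomalousDissipation.AnomalousDissipation.Theorems.WazewskiBlockUniformWorkFloorTrapStubCompactTruncationNorm
import Summits.AnomalousDissipation.AnomalousDissipation.Theorems.WazewskiBlockUniformWorkFloorTrapStubSpatialTruncation
import Summits.AnomalousDissipation.AnomalousDissipation.Theorems.WazewskiBlockUniformWorkFloorTrapStubSynthSlices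
import Summits.AnomalousDissipation.AnomalousDissipation.Theorems.WazewskiBlockUniformWorkFloorTrapStubCoeffCurveODE
import HarnessLib

/-!
# Route `WazewskiBlock`, crux `UniformWorkFloorTrap` (stmt-AnomalousDissipation-10353), line
# `work-lipschitz-cycles`: Galerkin persistence of a nondegenerate time-periodic Navier–Stokes orbit

Definition-free proof file (lead a1): the registered stub `stub_galerkinCyclePersistence` of the
line skeleton `Cruxes/UniformWorkFloorTrap/Lines/work_lipschitz_cycles.lean` — the Galerkin twin of
`Literature.Analysis.FluidPDE.PeriodicNSOrbitPersists` (Henry 1981, Thm. 8.3.2; proved in tree as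
`PeriodicNSOrbitPersists_holds`).  At FIXED viscosity `ν > 0`, a classical `τ`-periodic solution
of `NS_ν(f)` on `ℝ × T³` in the mean-zero leaf, with mean-zero Galerkin-mode force `f` of order
`m` and simple Floquet multiplier `1` (hypotheses (i), (ii) verbatim), persists for every large
Galerkin order `N` as a periodic orbit of `Torus.galerkinFlow ν f N`, uniformly `L²`-close in
time after the period rescaling.

Proof: `TimePeriodicLattice.persists_main` verbatim up to the kernel/range conditions; then
`stub_spatialTruncation`, `stub_compactTruncationNorm`, `stub_perturbedBorderedSolve` (Brezzi–Rappaz–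
Raviart 1980, Part I), coordinates/support/regularity of the truncated solution, the dictionary
`stub_synthSlices` + `stub_coeffCurveODE`, uniqueness `galerkinCoeffFlow_eq`, and `slice_h1_le`.
References: Henry 1981, Thm. 8.3.2; Brezzi–Rappaz–Raviart, Numer. Math. 36 (1980), Part I;
Titi, C. R. Acad. Sci. Paris 312 (1991) 41–43; Iooss, ARMA 47 (1972) §2–3.
-/

noncomputable section

-- `Summit.<Summit>.<Problem>`: single-conjunct summit, the duplicate namespace is mandated (CONVENTIONS §2).
set_option linter.dupNamespace false

namespace Summit.AnomalousDissipation.AnomalousDissipation.Theorems.UniformWorkFloorTrap.WorkLipschitzCycles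

open scoped InnerProductSpace Topology ENNReal NNReal ComplexConjugate
open MeasureTheory Filter Set Function UnitAddTorus
open Literature.Analysis.FunctionSpaces Literature.Analysis.FunctionSpaces.Torus
open Literature.Analysis.FunctionSpaces.EuclideanSpace
open Literature.Analysis.FluidPDE Literature.Analysis.FluidPDE.ScalarFourier
open Literature.Analysis.FluidPDE.TimePeriodicLattice

/-- The flat three-torus. -/
local notation "𝕋³" => UnitAddTorus (Fin 3)
/-- Velocity values on `T³`. -/
local notation "E³" => EuclideanSpace ℝ (Fin 3)
/-- Complexified velocity values (linearised problem). -/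
local notation "ℂ³" => EuclideanSpace ℂ (Fin 3)

-- NOTATION START (verbatim from `TimePeriodicNSLattice*` / `PeriodicNSOrbitPersistsProofs`)
/-- Local notation: the parabolic weight `Λ(n, k) = |n| + |k|²`. -/
local notation:max "Λ" m:max => (|((Prod.fst m : ℤ) : ℝ)| + freqNormSq (Prod.snd m))

/-- Local notation: the convective symbol on `ℤ × ℤ³`. -/
local notation:max "𝐍[" a ", " b "]" m:max =>
  (WithLp.toLp 2 (fun p : Fin 3 => ∑ j : Fin 3, ∑' m' : ℤ × (Fin 3 → ℤ),
    a m' j * (dsym j (Prod.snd m - Prod.snd m') * b (m - m') p)) : EuclideanSpace ℂ (Fin 3))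

/-- Local notation: division by the weight. -/
local notation:max "𝐜" x:max => (fun mm : ℤ × (Fin 3 → ℤ) =>
  ((((|((Prod.fst mm : ℤ) : ℝ)| + freqNormSq (Prod.snd mm))⁻¹ : ℝ) : ℂ) • x mm))

/-- Local notation: multiplication by the weight. -/
local notation:max "𝐬" x:max => (fun mm : ℤ × (Fin 3 → ℤ) =>
  ((((|((Prod.fst mm : ℤ) : ℝ)| + freqNormSq (Prod.snd mm)) : ℝ) : ℂ) • x mm))

/-- Local notation: the family of coefficients of `x ∈ W ⊂ ℓ²`. -/
local notation:max "𝐰" x:max =>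
  (((x : lp (fun _ : ℤ × (Fin 3 → ℤ) => EuclideanSpace ℂ (Fin 3)) 2)) : ℤ × (Fin 3 → ℤ) → EuclideanSpace ℂ (Fin 3))

/-- Local notation: the extension `K ↦ c (K₀, tail K)` of a lattice family to `ℤ⁴`. -/
local notation:max "𝐄" c:max => (fun K : Fin 4 → ℤ => c ((K 0, Fin.tail K) : ℤ × (Fin 3 → ℤ)))

/-- Local notation: the lattice family of the orbit `u` with period `τ`. -/
local notation:max "𝐨[" τ ", " u "]" => (fun mm : ℤ × (Fin 3 → ℤ) =>
  mFourierCoeff (EuclideanSpace.complexify ∘ fun y : UnitAddTorus (Fin 4) => Torus.timeRoll τ u y - ∫ x, u 0 x)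
    (Fin.cons (Prod.fst mm) (Prod.snd mm) : Fin 4 → ℤ))

/-- Local notation: the force family `y_F(n,k) = [k ≠ 0][n = 0] 𝓕(complexify ∘ F)(k)`. -/
local notation:max "𝐲" F:max => (fun mm : ℤ × (Fin 3 → ℤ) =>
  (ite (Prod.snd mm = 0) (0 : EuclideanSpace ℂ (Fin 3))
    (ite (Prod.fst mm = 0) (mFourierCoeff (EuclideanSpace.complexify ∘ F) (Prod.snd mm)) 0)))

/-- Local notation: the time multiplier `dₛ(n,k) = 2πi n / Λ(n,k)`. -/
local notation "dS" => (fun mm : ℤ × (Fin 3 → ℤ) =>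
  (2 * Real.pi * Complex.I * ((Prod.fst mm : ℤ) : ℂ)) * ((((|((Prod.fst mm : ℤ) : ℝ)| + freqNormSq (Prod.snd mm)) : ℝ) : ℂ))⁻¹)

/-- Local notation: the Stokes–drift multiplier `(4π²ν|k|² + 2πi m₀·k) / Λ(n,k)`. -/
local notation "dL[" ν ", " m₀ "]" => (fun mm : ℤ × (Fin 3 → ℤ) =>
  (((4 * Real.pi ^ 2 * ν * freqNormSq (Prod.snd mm) : ℝ) : ℂ) +
      2 * Real.pi * Complex.I * (∑ jj : Fin 3, ((m₀ jj : ℝ) : ℂ) * (((Prod.snd mm) jj : ℤ) : ℂ))) *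
    ((((|((Prod.fst mm : ℤ) : ℝ)| + freqNormSq (Prod.snd mm)) : ℝ) : ℂ))⁻¹)

/-- Local notation: the symbol `σ_om(n,k) = 2πiomn + 4π²ν|k|² + 2πi m₀·k`. -/
local notation "σ[" om ", " ν ", " m₀ "]" => (fun mm : ℤ × (Fin 3 → ℤ) =>
  2 * Real.pi * Complex.I * ((om : ℝ) : ℂ) * ((Prod.fst mm : ℤ) : ℂ) +
    (((4 * Real.pi ^ 2 * ν * freqNormSq (Prod.snd mm) : ℝ)) : ℂ) +
    2 * Real.pi * Complex.I * (∑ jj : Fin 3, ((m₀ jj : ℝ) : ℂ) * (((Prod.snd mm) jj : ℤ) : ℂ)))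
-- NOTATION END

-- One long assembly theorem: cumulative elaboration ≈ 1.5× the default budget, every step default-sized.
set_option maxHeartbeats 400000 in
/-- **Galerkin persistence of a nondegenerate cycle at fixed viscosity** (registered stub
`stub_galerkinCyclePersistence` of line `work-lipschitz-cycles`; the Galerkin twin of
`Literature.Analysis.FluidPDE.PeriodicNSOrbitPersists`, Henry 1981 Thm. 8.3.2, via the space–time
lattice of `PeriodicNSOrbitPersistsProofs` with the truncated nonlinearity `P_N B(x,x)`;
Brezzi–Rappaz–Raviart 1980, Part I; Titi 1991): for `ν > 0`, a mean-zero Galerkin-mode force `f` of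
order `m`, and a classical `τ`-periodic solution `(u, p)` of `NS_ν(f)` on `ℝ × T³` in the mean-zero
leaf with simple Floquet multiplier `1` (clauses (i), (ii)), for every `δ > 0` there is `N₀` such
that every Galerkin semiflow `Torus.galerkinFlow ν f N`, `N ≥ N₀`, has a periodic orbit (a Galerkin
mode `a`, a period `τ' > 0`, `galerkinFlow ν f N τ' a = a`) with
`∫ ‖galerkinFlow ν f N t a − u (τ t / τ')‖² ≤ δ` on `[0, τ']`. [cite: Henry1981, Thm. 8.3.2] -/
theorem stub_galerkinCyclePersistence :
    ∀ (ν τ : ℝ) (m : ℕ) (f : 𝕋³ → E³) (u : ℝ → 𝕋³ → E³) (p : ℝ → 𝕋³ → ℝ),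
      0 < ν → 0 < τ → IsGalerkinMode m f → HasZeroMean f →
      Torus.IsClassicalNSSolutionOn Set.univ ν (fun _ => f) u p → Function.Periodic u τ →
      (∀ t, HasZeroMean (u t)) →
      (∀ (w : ℝ → 𝕋³ → ℂ³) (q : ℝ → 𝕋³ → ℂ),
          Torus.IsSmoothSpaceTimeOn Set.univ w → Torus.IsSmoothSpaceTimeOn Set.univ q →
          (∀ t, Torus.IsDivFreeC (w t)) → (∀ t, HasZeroMean (w t)) → Function.Periodic w τ →
          (∀ t x, Torus.timeDerivWithin Set.univ w t x =
            Torus.linearizedNSOperator ν (u t) (w t) (q t) x) →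
          ∃ z : ℂ, ∀ t x, w t x =
            z • Torus.realToComplex (Torus.timeDerivWithin Set.univ u t x)) →
      (∀ (w : ℝ → 𝕋³ → ℂ³) (q : ℝ → 𝕋³ → ℂ),
          Torus.IsSmoothSpaceTimeOn Set.univ w → Torus.IsSmoothSpaceTimeOn Set.univ q →
          (∀ t, Torus.IsDivFreeC (w t)) → (∀ t, HasZeroMean (w t)) → Function.Periodic w τ →
          ∃ t x, Torus.timeDerivWithin Set.univ w t x ≠
            Torus.linearizedNSOperator ν (u t) (w t) (q t) x +
              Torus.realToComplex (Torus.timeDerivWithin Set.univ u t x)) →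
      ∀ δ : ℝ, 0 < δ → ∃ N₀ : ℕ, ∀ N : ℕ, N₀ ≤ N →
        ∃ (a : 𝕋³ → E³) (τ' : ℝ), IsGalerkinMode N a ∧ 0 < τ' ∧
          Torus.galerkinFlow ν f N τ' a = a ∧
          ∀ t ∈ Set.Icc (0 : ℝ) τ',
            ∫ x, ‖Torus.galerkinFlow ν f N t a x - u (τ / τ' * t) x‖ ^ 2 ≤ δ := by
  intro ν τ m f u p hν hτ hfG hf0 hsol hper hmean hK hR δ hδ
  obtain ⟨W, hW, hWc⟩ := exists_space -- the state space (verbatim `persists_main` from here to `hrange`)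
  haveI : CompleteSpace W := completeSpace_W hWc
  have hf : IsSmooth f := hfG.isSmooth
  have hfd : IsDivFree f := hfG.isDivFree
  have hU : IsSmooth (timeRoll τ u) := orbit_isSmooth hsol hper
  have hu0 : ∀ n : ℤ, 𝐨[τ, u] ((n, 0) : ℤ × (Fin 3 → ℤ)) = 0 := orbit_zero_modes hsol hper hf0
  have hut := orbit_transversal hsol hper
  have huc := orbit_conj hsol hper
  have hur := orbit_rapidDecay hsol hper
  have hmomx₀ : ∀ M : ℕ, ∑' mm : ℤ × (Fin 3 → ℤ), ENNReal.ofReal ((Λ mm) ^ M) * ‖(𝐬 (𝐨[τ, u])) mm‖ₑ ^ 2 ≠ ⊤ :=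
    fun M => moments_of_rapidDecay (C := mFourierCoeff (complexify ∘ fun y => timeRoll τ u y - ∫ x, u 0 x)) hur M
  have hx₀2 : ∑' mm : ℤ × (Fin 3 → ℤ), ‖(𝐬 (𝐨[τ, u])) mm‖ₑ ^ 2 ≠ ⊤ := by
    have := hmomx₀ 0; simpa only [pow_zero, ENNReal.ofReal_one, one_mul] using this
  obtain ⟨x₀, hx₀⟩ := exists_memW hW (v := 𝐬 (𝐨[τ, u])) hx₀2 (sw_zero_mode (x := 𝐨[τ, u]) hu0)
    (sw_transversal (x := 𝐨[τ, u]) hut) (sw_neg (x := 𝐨[τ, u]) huc)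
  have hcx₀ : 𝐜 (𝐰 x₀) = 𝐨[τ, u] := by rw [hx₀]; exact cw_sw (x := 𝐨[τ, u]) hu0
  have hg2 : ∑' mm : ℤ × (Fin 3 → ℤ),
      ‖(fun mm : ℤ × (Fin 3 → ℤ) => (2 * Real.pi * Complex.I * (mm.1 : ℂ)) • (𝐬 (𝐨[τ, u])) mm) mm‖ₑ ^ 2 ≠ ⊤ := by
    have h1 := tsum_enorm_nsmul_sq_le (𝐬 (𝐨[τ, u])) 0
    simp only [pow_zero, ENNReal.ofReal_one, one_mul, zero_add] at h1
    exact ne_top_of_le_ne_top (ENNReal.mul_ne_top ENNReal.ofReal_ne_top (hmomx₀ 2)) h1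
  obtain ⟨g, hg⟩ := exists_memW hW
    (v := fun mm : ℤ × (Fin 3 → ℤ) => (2 * Real.pi * Complex.I * (mm.1 : ℂ)) • (𝐬 (𝐨[τ, u])) mm)
    hg2 (nsmul_zero_mode (x := 𝐬 (𝐨[τ, u])) (sw_zero_mode (x := 𝐨[τ, u]) hu0))
    (nsmul_transversal (x := 𝐬 (𝐨[τ, u])) (sw_transversal (x := 𝐨[τ, u]) hut))
    (nsmul_neg (x := 𝐬 (𝐨[τ, u])) (sw_neg (x := 𝐨[τ, u]) huc))
  obtain ⟨Ds, hDs, -⟩ := exists_diag hW (d := dS) (M := 2 * Real.pi) norm_dS_le dS_neg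
  obtain ⟨L₀, hL₀, -⟩ := exists_diag hW (d := dL[ν, ∫ x, u 0 x]) norm_dL_le dL_neg
  obtain ⟨c₁, hc₁, hcl₁⟩ := exists_symbol_lower_bound (inv_pos.2 hτ) hν (∫ x, u 0 x)
  obtain ⟨J, hJ1, -, -, -⟩ := exists_diagEquiv hW
    (d := fun mm => ((τ⁻¹ : ℝ) : ℂ) * dS mm + dL[ν, ∫ x, u 0 x] mm)
    (norm_omega_dS_add_dL_le τ⁻¹) (omega_dS_add_dL_neg τ⁻¹) hc₁ (le_norm_omega_dS_add_dL hcl₁)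
  have hJ : ∀ h : W, J h = τ⁻¹ • Ds h + L₀ h := fun h => W_ext fun mm => by
    rw [hJ1, coeW_add, coeW_smul, Pi.add_apply, Pi.smul_apply, hDs, hL₀, ← Complex.coe_smul, smul_smul,
      ← add_smul]
  obtain ⟨B, hBf, hBb⟩ := exists_bilinear hW
  obtain ⟨K, hK'⟩ : ∃ K : W →L[ℝ] W, ∀ w, K w = B x₀ w + B w x₀ :=
    ⟨(hBb.deriv (x₀, x₀)).comp ((ContinuousLinearMap.id ℝ W).prod (ContinuousLinearMap.id ℝ W)), fun w => by
      simp [IsBoundedBilinearMap.deriv_apply]⟩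
  have hx₀w : ∑' mm : ℤ × (Fin 3 → ℤ), ENNReal.ofReal ((1 + Λ mm) * sobolevWeight 1 mm.2) * ‖(𝐜 (𝐰 x₀)) mm‖ₑ ≠ ⊤ := by
    rw [hcx₀]; exact tsum_wt_weight_enorm_ne_top_of_rapidDecay hur
  have hKc : IsCompactOperator K := isCompactOperator_linearised hW hWc hBf x₀ hx₀w K hK'
  have hker : ∀ h : W, J h + K h = 0 → ∃ z : ℝ, h = z • g := fun h hh =>
    ker_condition hW hDs hL₀ hBf hν hτ hsol hper hf0 hK x₀ hx₀ g hg h (by rw [← hJ h, ← hK' h]; exact hh)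
  have hrange : ∀ h : W, J h + K h ≠ Ds x₀ := fun h hh =>
    range_condition hW hDs hL₀ hBf hν hτ hsol hper hf0 hR x₀ hx₀ h (by rw [← hJ h, ← hK' h]; exact hh)
  -- ### NEW: the spatial truncations and the perturbed bordered solve
  obtain ⟨P, hP, hP1, hPs⟩ := stub_spatialTruncation hW
  have hPK : Tendsto (fun n => ‖(P n).comp K - K‖) atTop (𝓝 0) := stub_compactTruncationNorm K hKc P hP1 hPs
  have hPB : Tendsto (fun n => P n (B x₀ x₀)) atTop (𝓝 (B x₀ x₀)) := hPs _
  obtain ⟨ε, hε⟩ : ∃ ε : ℝ, ε = Real.sqrt (δ / (3 * (1 + 4 * Real.pi ^ 2))) := ⟨_, rfl⟩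
  have hε0 : 0 < ε := by rw [hε]; exact Real.sqrt_pos.2 (by positivity)
  have hε2 : 3 * (1 + 4 * Real.pi ^ 2) * ε ^ 2 = δ := by
    rw [hε, Real.sq_sqrt (by positivity)]; field_simp
  obtain ⟨δ₁, hδ₁⟩ : ∃ δ₁ : ℝ, δ₁ = min (τ⁻¹ / 2) ε := ⟨_, rfl⟩
  have hδ₁0 : 0 < δ₁ := by rw [hδ₁]; exact lt_min (by positivity) hε0
  obtain ⟨N₁, hN₁⟩ := stub_perturbedBorderedSolve Ds L₀ hBb x₀ τ⁻¹ J hJ K hK' hKc g hker hrange P hP1 hPK hPB hδ₁0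
  -- ### the force family of the orbit
  have hyf2 : ∀ {F : UnitAddTorus (Fin 3) → EuclideanSpace ℝ (Fin 3)}, IsSmooth F →
      ∑' mm : ℤ × (Fin 3 → ℤ), ‖(𝐲 F) mm‖ₑ ^ 2 ≠ ⊤ :=
    fun hF => by have := tsum_moment_yf_ne_top hF 0; simpa only [pow_zero, ENNReal.ofReal_one, one_mul] using this
  obtain ⟨Yf, hYf⟩ := exists_memW hW (v := 𝐲 f) (hyf2 hf) (yf_zero_mode f) (yf_transversal hf hfd) (yf_neg hf.continuous)
  have hy0 : τ⁻¹ • Ds x₀ + L₀ x₀ + B x₀ x₀ = Yf := by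
    refine W_ext fun mm => ?_
    by_cases hm : mm.2 = 0
    · rw [W_zero' hW _ hm, W_zero' hW _ hm]
    · rw [coord_G hDs hL₀ hBf x₀ τ⁻¹ mm, hYf, hcx₀, yf_of_snd_ne_zero f hm]
      exact orbit_equation hsol hper hτ hfd mm hm
  -- ### the threshold
  refine ⟨max N₁ m, fun N hN => ?_⟩
  have hN₁N : N₁ ≤ N := le_of_max_le_left hN
  have hmN : m ≤ N := le_of_max_le_right hN
  obtain ⟨x, om, hGx, hxx₀, homτ⟩ := hN₁ N hN₁N
  rw [hy0] at hGx
  have hom : 0 < om := by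
    have h1 := (abs_lt.1 homτ).1
    have h2 : δ₁ ≤ τ⁻¹ / 2 := by rw [hδ₁]; exact min_le_left _ _
    have h3 : 0 < τ⁻¹ := inv_pos.2 hτ
    linarith
  -- ### the lattice family `c = x/Λ` and its truncated equation
  have hc0 : ∀ n : ℤ, (𝐜 (𝐰 x)) (n, 0) = 0 := cw_zero_mode (W_zero hW x)
  have hct : ∀ mm : ℤ × (Fin 3 → ℤ), (∑ jj : Fin 3, ((mm.2 jj : ℤ) : ℂ) * ((𝐜 (𝐰 x)) mm) jj) = 0 :=
    cw_transversal (W_trans hW x)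
  have hcs : ∀ mm : ℤ × (Fin 3 → ℤ), (𝐜 (𝐰 x)) (-mm) = conjVec ((𝐜 (𝐰 x)) mm) := cw_neg (W_conj hW x)
  have hcoordP : ∀ mm : ℤ × (Fin 3 → ℤ), (𝐰 ((om • Ds x + L₀ x + P N (B x x) : W))) mm =
      σ[om, ν, ∫ x, u 0 x] mm • (𝐜 (𝐰 x)) mm +
        (if freqNormSq mm.2 ≤ (N : ℝ) ^ 2 then Torus.lerayCoeff mm.2 (𝐍[𝐜 (𝐰 x), 𝐜 (𝐰 x)] mm) else 0) := by
    intro mm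
    rw [coeW_add, coeW_add, coeW_smul, Pi.add_apply, Pi.add_apply, Pi.smul_apply, hDs, hL₀, hP, hBf]
    congr 1
    rw [← Complex.coe_smul, smul_smul, ← add_smul, omega_dS_add_dL, ← smul_smul, ← Complex.ofReal_inv]
  have hceq : ∀ mm : ℤ × (Fin 3 → ℤ), mm.2 ≠ 0 →
      σ[om, ν, ∫ x, u 0 x] mm • (𝐜 (𝐰 x)) mm +
        (if freqNormSq mm.2 ≤ (N : ℝ) ^ 2 then Torus.lerayCoeff mm.2 (𝐍[𝐜 (𝐰 x), 𝐜 (𝐰 x)] mm) else 0) =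
        if mm.1 = 0 then mFourierCoeff (complexify ∘ f) mm.2 else 0 := by
    intro mm hm
    have h1 := congrArg (fun z : W => (𝐰 z) mm) hGx
    simp only at h1
    rw [hcoordP mm, hYf, yf_of_snd_ne_zero f hm] at h1
    exact h1
  -- ### support in the ball `|k|² ≤ N²` (uses `N ≥ m`: the force has no modes there)
  obtain ⟨c₂, hc₂, hcl₂⟩ := exists_symbol_lower_bound hom hν (∫ x, u 0 x)
  have hsupp : ∀ mm : ℤ × (Fin 3 → ℤ), (N : ℝ) ^ 2 < freqNormSq mm.2 → (𝐜 (𝐰 x)) mm = 0 := by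
    intro mm hmm
    have hm : mm.2 ≠ 0 := by
      intro h0; rw [h0, freqNormSq_zero] at hmm; exact absurd hmm (not_lt.2 (sq_nonneg _))
    have he := hceq mm hm
    rw [if_neg (not_le.2 hmm), add_zero] at he
    have hfk : mFourierCoeff (complexify ∘ f) mm.2 = 0 := by
      refine hfG.mFourierCoeff_eq_zero (lt_of_le_of_lt ?_ hmm)
      exact_mod_cast Nat.pow_le_pow_left hmN 2
    have hrhs : (if mm.1 = 0 then mFourierCoeff (complexify ∘ f) mm.2 else 0) = 0 := by
      split_ifs <;> simp [hfk]
    rw [hrhs] at he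
    have hσ : σ[om, ν, ∫ x, u 0 x] mm ≠ 0 := by
      intro h0
      have := hcl₂ mm hm
      beta_reduce at h0
      rw [h0, norm_zero] at this
      exact absurd this (not_le.2 (mul_pos hc₂ (wt_pos hm)))
    exact (smul_eq_zero.1 he).resolve_left hσ
  -- ### parabolic regularity of `c`
  have hmomX₀ : ∀ M : ℕ, ∑' mm, ENNReal.ofReal ((Λ mm) ^ M) * ‖(𝐰 x₀) mm‖ₑ ^ 2 ≠ ⊤ := by
    intro M; rw [hx₀]; exact hmomx₀ M
  have hineq : ∀ mm : ℤ × (Fin 3 → ℤ), mm.2 ≠ 0 →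
      c₂ * ‖(𝐰 x) mm‖ ≤ ‖(𝐲 f) mm‖ + ‖𝐍[𝐜 (𝐰 x), 𝐜 (𝐰 x)] mm‖ + ‖𝐍[𝐜 (𝐰 x₀), 𝐜 (𝐰 x)] mm‖ +
        ‖𝐍[𝐜 (𝐰 x), 𝐜 (𝐰 x₀)] mm‖ := by
    intro mm hm
    have he := hceq mm hm
    have hL : (Λ mm) ≠ 0 := ne_of_gt (lt_of_lt_of_le one_pos (one_le_wt hm))
    have hxm : ‖(𝐰 x) mm‖ = Λ mm * ‖(𝐜 (𝐰 x)) mm‖ := by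
      have e1 : ‖(𝐜 (𝐰 x)) mm‖ = (Λ mm)⁻¹ * ‖(𝐰 x) mm‖ := by
        change ‖((((Λ mm)⁻¹ : ℝ)) : ℂ) • (𝐰 x) mm‖ = _
        rw [norm_smul, Complex.norm_real, Real.norm_of_nonneg (inv_nonneg.2 (wt_nonneg mm))]
      rw [e1, ← mul_assoc, mul_inv_cancel₀ hL, one_mul]
    have hσ := hcl₂ mm hm
    have htrunc : ‖(if freqNormSq mm.2 ≤ (N : ℝ) ^ 2 then Torus.lerayCoeff mm.2 (𝐍[𝐜 (𝐰 x), 𝐜 (𝐰 x)] mm) else 0)‖ ≤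
        ‖𝐍[𝐜 (𝐰 x), 𝐜 (𝐰 x)] mm‖ := by
      split_ifs
      · exact SteadyLattice.norm_lerayCoeff_le _ _
      · rw [norm_zero]; exact norm_nonneg _
    have h1 : ‖σ[om, ν, ∫ x, u 0 x] mm • (𝐜 (𝐰 x)) mm‖ ≤ ‖(𝐲 f) mm‖ + ‖𝐍[𝐜 (𝐰 x), 𝐜 (𝐰 x)] mm‖ := by
      rw [show σ[om, ν, ∫ x, u 0 x] mm • (𝐜 (𝐰 x)) mm = (𝐲 f) mm -
        (if freqNormSq mm.2 ≤ (N : ℝ) ^ 2 then Torus.lerayCoeff mm.2 (𝐍[𝐜 (𝐰 x), 𝐜 (𝐰 x)] mm) else 0) by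
        rw [yf_of_snd_ne_zero f hm, ← he]; exact (add_sub_cancel_right _ _).symm]
      exact (norm_sub_le _ _).trans (add_le_add le_rfl htrunc)
    rw [norm_smul] at h1
    have h0 : 0 ≤ ‖𝐍[𝐜 (𝐰 x₀), 𝐜 (𝐰 x)] mm‖ := norm_nonneg _
    have h0' : 0 ≤ ‖𝐍[𝐜 (𝐰 x), 𝐜 (𝐰 x₀)] mm‖ := norm_nonneg _
    calc c₂ * ‖(𝐰 x) mm‖ = (c₂ * Λ mm) * ‖(𝐜 (𝐰 x)) mm‖ := by rw [hxm]; ring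
      _ ≤ ‖σ[om, ν, ∫ x, u 0 x] mm‖ * ‖(𝐜 (𝐰 x)) mm‖ := mul_le_mul_of_nonneg_right hσ (norm_nonneg _)
      _ ≤ _ := by linarith
  have hmomc := moments_of_lattice_ineq hc₂ (𝐰 x) (𝐰 x₀) (𝐲 f) (W_zero hW x) (W_zero hW x₀) (l2_tsum_enorm_sq_ne_top _)
    hmomX₀ (tsum_moment_yf_ne_top hf) hineq
  have hcr : RapidDecay (𝐄 (𝐜 (𝐰 x))) := rapidDecay_of_moments (W_zero hW x) hmomc
  -- ### the drift-free truncated equation on the ball (mean-zero leaf)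
  have hm0 : (∫ x, u 0 x) = 0 := hmean 0
  have heq' : ∀ mm : ℤ × (Fin 3 → ℤ), mm.2 ≠ 0 → freqNormSq mm.2 ≤ (N : ℝ) ^ 2 →
      (2 * Real.pi * Complex.I * (om : ℂ) * (mm.1 : ℂ) + ((4 * Real.pi ^ 2 * ν * freqNormSq mm.2 : ℝ) : ℂ)) •
          (𝐜 (𝐰 x)) mm + Torus.lerayCoeff mm.2 (𝐍[𝐜 (𝐰 x), 𝐜 (𝐰 x)] mm) =
        if mm.1 = 0 then mFourierCoeff (complexify ∘ f) mm.2 else 0 := by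
    intro mm hm hle
    have he := hceq mm hm
    rw [if_pos hle] at he
    rw [← he]
    congr 1
    simp only [hm0, PiLp.zero_apply, Complex.ofReal_zero, zero_mul, Finset.sum_const_zero, mul_zero, add_zero]
  have hfN : IsGalerkinMode N f :=
    ⟨hf, hfd, fun k hk => hfG.mFourierCoeff_eq_zero (lt_of_le_of_lt (by exact_mod_cast Nat.pow_le_pow_left hmN 2) hk)⟩
  -- ### the dictionary stubs
  obtain ⟨hslice, hcoef⟩ := stub_synthSlices (𝐜 (𝐰 x)) N om hc0 hct hcs hsupp hcr
  obtain ⟨hcont, hderiv⟩ := stub_coeffCurveODE (𝐜 (𝐰 x)) N om ν f hom hfN hf0 hc0 hct hcs hsupp hcr heq'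
  -- the realised field and its coefficient curve
  obtain ⟨u', hu'⟩ : ∃ u' : ℝ → 𝕋³ → E³, u' = fun t x' =>
      EuclideanSpace.realPart (fourierSynth (𝐄 (𝐜 (𝐰 x))) (Fin.cons (((om * t : ℝ)) : UnitAddCircle) x')) :=
    ⟨_, rfl⟩
  obtain ⟨α, hαdef⟩ : ∃ α : ℝ → ↥(freqBall N : Finset (Fin 3 → ℤ)) → ℂ³,
      α = fun (t : ℝ) (k : ↥(freqBall N : Finset (Fin 3 → ℤ))) =>
        ∑' n : ℤ, (fourier n (((om * t : ℝ)) : UnitAddCircle) : ℂ) • (𝐜 (𝐰 x)) (n, (k : Fin 3 → ℤ)) :=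
    ⟨_, rfl⟩
  have hcont' : Continuous α := by rw [hαdef]; exact hcont
  have hderiv' : ∀ t, HasDerivAt α (galerkinRHS (freqBall N) ν (fourierRestrict (freqBall N) f) (α t)) t := by
    intro t; rw [hαdef]; exact hderiv t
  have hslice' : ∀ t, IsGalerkinMode N (u' t) := by
    intro t; rw [hu']; exact hslice t
  have hα : ∀ t, fourierRestrict (freqBall N) (u' t) = α t := by
    intro t; funext k
    rw [fourierRestrict_apply, hαdef, hu']
    exact hcoef t k
  have hODE : IsGalerkinODESolution ν (fourierRestrict (freqBall N) f) (α 0) α :=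
    ⟨rfl, fun t => by rw [← hα t]; exact (hslice' t).fourierRestrict_mem, hcont'.continuousOn,
      fun T t _ => (hderiv' t).hasDerivWithinAt⟩
  have hflow : ∀ t, 0 ≤ t → Torus.galerkinFlow ν f N t (u' 0) = u' t := by
    intro t ht
    rw [(hslice' 0).galerkinFlow_eq t, hα 0, hODE.galerkinCoeffFlow_eq ht, ← hα t]
    exact (hslice' t).realTrigPoly_fourierRestrict
  have hper' : Function.Periodic u' om⁻¹ := by
    rw [hu']
    exact periodic_comp_cons (fun y => EuclideanSpace.realPart (fourierSynth (𝐄 (𝐜 (𝐰 x))) y)) hom.ne'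
  refine ⟨u' 0, om⁻¹, hslice' 0, inv_pos.2 hom, ?_, fun t ht => ?_⟩
  · rw [hflow _ (inv_pos.2 hom).le]
    have := hper' 0
    rwa [zero_add] at this
  · rw [hflow t ht.1]
    -- ### the closeness estimate via the slice `H¹` bound
    obtain ⟨hV's, -, hVcoef⟩ := realSynth_spec' hcr (ext_neg_eq_conjVec (c := 𝐜 (𝐰 x)) hcs)
    obtain ⟨D, hDdef⟩ : ∃ D : UnitAddTorus (Fin 4) → EuclideanSpace ℝ (Fin 3),
        D = fun y => EuclideanSpace.realPart (fourierSynth (𝐄 (𝐜 (𝐰 x))) y) - (timeRoll τ u y - ∫ x, u 0 x) :=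
      ⟨_, rfl⟩
    have hV : IsSmooth (fun y => timeRoll τ u y - ∫ x, u 0 x) := hU.sub (isSmooth_const _)
    have hD : IsSmooth D := by rw [hDdef]; exact hV's.sub hV
    have he0 : ∀ n : ℤ, (𝐰 ((x - x₀ : W))) (n, 0) = 0 := W_zero hW _
    have he2 : ∑' mm, ‖(𝐰 ((x - x₀ : W))) mm‖ₑ ^ 2 ≠ ⊤ := l2_tsum_enorm_sq_ne_top _
    have he : ∀ mm : ℤ × (Fin 3 → ℤ), mFourierCoeff (complexify ∘ D) (Fin.cons mm.1 mm.2) = (𝐜 (𝐰 ((x - x₀ : W)))) mm := by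
      intro mm
      have hsplit : (complexify ∘ D) =
          (complexify ∘ fun y => EuclideanSpace.realPart (fourierSynth (𝐄 (𝐜 (𝐰 x))) y)) -
          (complexify ∘ fun y => timeRoll τ u y - ∫ x, u 0 x) := by
        rw [hDdef]; funext y; simp only [Function.comp_apply, Pi.sub_apply, map_sub]
      have hVc : IsSmooth (complexify ∘ fun y => timeRoll τ u y - ∫ x, u 0 x) :=
        hV.comp_clm complexify.toContinuousLinearMap
      have hRc : IsSmooth (complexify ∘ fun y => EuclideanSpace.realPart (fourierSynth (𝐄 (𝐜 (𝐰 x))) y)) :=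
        hV's.comp_clm complexify.toContinuousLinearMap
      have h2 : mFourierCoeff (complexify ∘ fun y => EuclideanSpace.realPart (fourierSynth (𝐄 (𝐜 (𝐰 x))) y))
          (Fin.cons mm.1 mm.2) = (𝐜 (𝐰 x)) mm := (hVcoef _).trans (ext_cons (𝐜 (𝐰 x)) mm)
      have e1 := congrArg (fun F : ℤ × (Fin 3 → ℤ) → EuclideanSpace ℂ (Fin 3) => F mm) hcx₀
      simp only at e1
      rw [hsplit, mFourierCoeff_sub hRc.integrable hVc.integrable, h2, ← e1, coeW_sub]
      beta_reduce
      rw [Pi.sub_apply, smul_sub]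
    have hbound := slice_h1_le (D := D) hD (𝐰 ((x - x₀ : W))) he0 he he2 (((om * t : ℝ)) : UnitAddCircle)
    have hnorm : (∑' mm, ‖(𝐰 ((x - x₀ : W))) mm‖ₑ ^ 2).toReal = ‖x - x₀‖ ^ 2 := tsum_enorm_sq_toReal_eq _
    rw [hnorm] at hbound
    have hfun : ∀ x' : UnitAddTorus (Fin 3), u' t x' - u (τ / om⁻¹ * t) x' =
        timeSlice D (((om * t : ℝ)) : UnitAddCircle) x' := by
      intro x'
      rw [timeSlice_apply, hDdef, hu']
      beta_reduce
      rw [timeRoll_cons hper (om * t) x', show τ / om⁻¹ * t = τ * (om * t) by rw [div_inv_eq_mul, mul_assoc], hm0,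
        sub_zero]
    have hδ₁ε : δ₁ ≤ ε := by rw [hδ₁]; exact min_le_right _ _
    have hxx : ‖x - x₀‖ ^ 2 ≤ ε ^ 2 := by
      have := hxx₀.le.trans hδ₁ε
      exact pow_le_pow_left₀ (norm_nonneg _) this 2
    have hgrad : 0 ≤ gradNormSq (timeSlice D (((om * t : ℝ)) : UnitAddCircle)) := gradNormSq_nonneg _
    calc (∫ x', ‖u' t x' - u (τ / om⁻¹ * t) x'‖ ^ 2)
        = ∫ x', ‖timeSlice D (((om * t : ℝ)) : UnitAddCircle) x'‖ ^ 2 := by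
          have hint : (fun x' : UnitAddTorus (Fin 3) => ‖u' t x' - u (τ / om⁻¹ * t) x'‖ ^ 2) =
              fun x' => ‖timeSlice D (((om * t : ℝ)) : UnitAddCircle) x'‖ ^ 2 := funext fun x' => by rw [hfun x']
          rw [hint]
      _ ≤ (∫ x', ‖timeSlice D (((om * t : ℝ)) : UnitAddCircle) x'‖ ^ 2) +
            gradNormSq (timeSlice D (((om * t : ℝ)) : UnitAddCircle)) := le_add_of_nonneg_right hgrad
      _ ≤ (3 * (1 + 4 * Real.pi ^ 2)) * ‖x - x₀‖ ^ 2 := hbound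
      _ ≤ (3 * (1 + 4 * Real.pi ^ 2)) * ε ^ 2 := by gcongr
      _ = δ := hε2

end Summit.AnomalousDissipation.AnomalousDissipation.Theorems.UniformWorkFloorTrap.WorkLipschitzCycles

end
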